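import Summits.HubbardSuperconductivity.HubbardSuperconductivity.Theorems.FunctionFieldCertificateMesoscopicPairOrderBlockCertificate
import HarnessLib

/-!
# `MesoscopicPairOrder` (stmt-HubbardSuperconductivity-7331), line `pointwise_split`:
# what ONE certified block scale buys at a point where the Goldstone profile holds

Companion of `FunctionFieldCertificateMesoscopicPairOrderBlockCertificate.lean` (stub (B) in certificate
language: `certificate_at_of_observable`, block soundness `blockMargin_le_of_certificate`, block
completeness `blockCertificate_at`, `leakBeatingBlockPairSeed_iff_blockCertified`). Here the POINTWISE
ENDGAME of line `pointwise_split` is recorded as theorems: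

* `uniformPairOrder_of_profileAt_of_blockCertified` — at a point `(U, δ)` where the Goldstone pair profile
  of stub (A) holds with constants `(S, A)`, an eventual family of evaluated block certificates for
  `L⁻² • K_{R₀} - (m₀ R₀² - C/L) • 1` at ONE block scale `R₀` with a margin beating the leak
  `32 ε (S ε + A) + (S + A/ε)/R₀²` gives UNIFORM sector pair order `a = (m₀ - leak)/2 > 0` at that point
  (block soundness per side, the slack `C/L` absorbed by the strict leak inequality, then the pointwise
  one-scale closure `pairStructureFactor_zero_ge_of_seed_of_profile`);
* `meso_and_summit_of_profileAt_of_blockCertified` — hence `MesoscopicPairOrder`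
  (`mesoscopicPairOrder_of_uniformPairOrder`) AND the summit `HubbardSuperconductivity`
  (`TwTipContinuation.Negative.summitMatrix_of_everyGSOrder`, as in `certificateSoundness_proof`).

So the composition of the line consumes stub (A) at stub (B)'s witness point only, and the route's
endgame in the pointwise accounting is: (A)'s constants at ONE point + ONE `L`-uniform family of
finite-range certificates at ONE scale. Folklore bookkeeping over landed tree lemmas
(Kennedy–Lieb–Shastry, PRL 61 (1988) 2582, for the Parseval accounting; Tasaki (2020) §2.1–2.2).
No definition, no named fact, no sorry; nothing here claims (A), (B) or any certificate.
-/

noncomputable section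

-- the summit namespace repeats the problem name by design (D-0017)
set_option linter.dupNamespace false

namespace Summit.HubbardSuperconductivity.HubbardSuperconductivity.Theorems.FunctionFieldCertificate

open Matrix Finset Filter
open Literature.Probability.LatticeModels Literature.MathematicalPhysics.QuantumLattice
open Literature.Barriers.HubbardSuperconductivity
open Summit.HubbardSuperconductivity.HubbardSuperconductivity.Theses.FunctionFieldCertificate
open scoped ComplexOrder ComplexConjugate

/-! ### §5 What one certified scale buys at a point where the profile holds -/

/-- **Pointwise endgame: uniform sector pair order.** At a point `(U, δ)`: if the Goldstone pair profile
of stub (A) holds there with constants `S, A ≥ 0` (every normalised `(N_L, 0)`-sector ground state,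
even `L ≥ L_A`, all `m ≠ 0`: `S_ψ(m) ≤ S + A/|q_m|`), and at ONE block scale `R₀ > 0` there are evaluated
block certificates for `L⁻² • K_{R₀} - (m₀ R₀² - C/L) • 1` along the even sides `L ≥ L_B` with a margin
beating the leak, `32 ε (S ε + A) + (S + A/ε)/R₀² < m₀`, then every normalised sector ground state of
every large even torus has `a ≤ Re⟨ψ, Δ_dᴴ Δ_d ψ⟩/L⁴` with `a = (m₀ - leak)/2 > 0`: soundness per side
(`blockMargin_le_of_certificate`), slack absorbed as in §4, then the pointwise one-scale closure
`pairStructureFactor_zero_ge_of_seed_of_profile`. Stub (A) is consumed at THIS point only.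
Kennedy–Lieb–Shastry, PRL 61 (1988) 2582 (Parseval accounting). [folklore] -/
theorem uniformPairOrder_of_profileAt_of_blockCertified {U δ S A ε m₀ C : ℝ} {R₀ L_A L_B : ℕ}
    (hS : 0 ≤ S) (hA : 0 ≤ A) (hR₀ : 0 < R₀) (hε : 0 < ε)
    (hleak : 32 * ε * (S * ε + A) + (S + A / ε) / (R₀ : ℝ) ^ 2 < m₀)
    (hprof : ∀ (L : ℕ) [NeZero L], L_A ≤ L → Even L →
      ∀ ψ : Fock (Orb (FermionTorus 2 L)), star ψ ⬝ᵥ ψ = 1 →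
        IsGroundStateInSector (hubbardTorus 2 L 1 U) (2 * ⌊(1 - δ) * (L : ℝ) ^ 2 / 2⌋₊) 0 ψ →
          ∀ m : TorusSite 2 L, m ≠ 0 →
            pairStructureFactor dWaveFormFactor L ψ m ≤ S + A / Real.sqrt (momentumNormSq L m))
    (hcert : ∀ (L : ℕ) [NeZero L], L_B ≤ L → Even L →
      ∃ (n m : ℕ)
        (O : Fin n → Matrix (Finset (Orb (FermionTorus 2 L))) (Finset (Orb (FermionTorus 2 L))) ℂ)
        (Q : Fin m → Matrix (Finset (Orb (FermionTorus 2 L))) (Finset (Orb (FermionTorus 2 L))) ℂ)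
        (R T : Matrix (Finset (Orb (FermionTorus 2 L))) (Finset (Orb (FermionTorus 2 L))) ℂ),
        (∀ (i : Fin m) (ψ : Fock (Orb (FermionTorus 2 L))),
          ψ ∈ szSector (2 * ⌊(1 - δ) * (L : ℝ) ^ 2 / 2⌋₊) 0 →
            Q i *ᵥ ψ ∈ szSector (2 * ⌊(1 - δ) * (L : ℝ) ^ 2 / 2⌋₊) 0) ∧
        (∀ ψ : Fock (Orb (FermionTorus 2 L)),
          ψ ∈ szSector (2 * ⌊(1 - δ) * (L : ℝ) ^ 2 / 2⌋₊) 0 → star ψ ⬝ᵥ T *ᵥ ψ = 0) ∧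
        (1 / (L : ℂ) ^ 2) • (∑ x : TorusSite 2 L, ∑ y : TorusSite 2 L,
            ((∏ i : Fin 2, max 0 (1 - |(((y i - x i).valMinAbs : ℤ) : ℝ)| / (R₀ : ℝ)) : ℝ) : ℂ) •
              ((localPair dWaveFormFactor L x)ᴴ * localPair dWaveFormFactor L y)) -
            ((m₀ * (R₀ : ℝ) ^ 2 - C / (L : ℝ) : ℝ) : ℂ) •
              (1 : Matrix (Finset (Orb (FermionTorus 2 L))) (Finset (Orb (FermionTorus 2 L))) ℂ) =
          ∑ i : Fin n, (O i)ᴴ * O i +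
            ∑ i : Fin m, (Q i)ᴴ * (hubbardTorus 2 L 1 U * Q i - Q i * hubbardTorus 2 L 1 U) +
            (hubbardTorus 2 L 1 U * R - R * hubbardTorus 2 L 1 U) + T) :
    ∃ a : ℝ, 0 < a ∧ ∃ L₀ : ℕ, ∀ (L : ℕ) [NeZero L], L₀ ≤ L → Even L →
      ∀ ψ : Fock (Orb (FermionTorus 2 L)), star ψ ⬝ᵥ ψ = 1 →
        IsGroundStateInSector (hubbardTorus 2 L 1 U) (2 * ⌊(1 - δ) * (L : ℝ) ^ 2 / 2⌋₊) 0 ψ →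
          a ≤ (star ψ ⬝ᵥ Matrix.mulVec (Matrix.conjTranspose (pairField dWaveFormFactor L) *
            pairField dWaveFormFactor L) ψ).re / (L : ℝ) ^ 4 := by
  set leak : ℝ := 32 * ε * (S * ε + A) + (S + A / ε) / (R₀ : ℝ) ^ 2 with hleak_def
  set a : ℝ := (m₀ - leak) / 2 with ha_def
  have ha : 0 < a := by rw [ha_def]; linarith
  have hRpos : (0 : ℝ) < R₀ := Nat.cast_pos.2 hR₀
  have haR : 0 < a * (R₀ : ℝ) ^ 2 := by positivity
  refine ⟨a, ha, max (max L_A L_B) (max (2 * R₀) ⌈|C| / (a * (R₀ : ℝ) ^ 2)⌉₊),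
    fun L _ hL hE ψ hψ1 hgs => ?_⟩
  have hLA : L_A ≤ L := le_trans (le_max_left _ _) (le_of_max_le_left hL)
  have hLB : L_B ≤ L := le_trans (le_max_right _ _) (le_of_max_le_left hL)
  have h2R : 2 * R₀ ≤ L := le_trans (le_max_left _ _) (le_of_max_le_right hL)
  have hceil : ⌈|C| / (a * (R₀ : ℝ) ^ 2)⌉₊ ≤ L := le_trans (le_max_right _ _) (le_of_max_le_right hL)
  have hLpos : (0 : ℝ) < L := Nat.cast_pos.2 (Nat.pos_of_ne_zero (NeZero.ne L))
  have hL2 : (0 : ℝ) < (L : ℝ) ^ 2 := by positivity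
  obtain ⟨n, m, O, Q, R, T, hQ, hT, hId⟩ := hcert L hLB hE
  have hsound := blockMargin_le_of_certificate R₀ O Q R T hQ hT hId hψ1 hgs
  -- `C/L ≤ a R₀²`
  have hCL : C / (L : ℝ) ≤ a * (R₀ : ℝ) ^ 2 := by
    have h1 : ((⌈|C| / (a * (R₀ : ℝ) ^ 2)⌉₊ : ℕ) : ℝ) ≤ (L : ℝ) := by exact_mod_cast hceil
    have h2 : |C| / (a * (R₀ : ℝ) ^ 2) ≤ (L : ℝ) := (Nat.le_ceil _).trans h1
    rw [div_le_iff₀ haR] at h2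
    rw [div_le_iff₀ hLpos]
    calc C ≤ |C| := le_abs_self C
      _ ≤ (L : ℝ) * (a * (R₀ : ℝ) ^ 2) := h2
      _ = a * (R₀ : ℝ) ^ 2 * (L : ℝ) := by ring
  -- the seed at the single scale `R₀` with margin `m₀ - a`
  have hseed : (m₀ - a) * (R₀ : ℝ) ^ 2 ≤ (∑ x : TorusSite 2 L, ∑ y : TorusSite 2 L,
      (∏ i : Fin 2, max 0 (1 - |(((y i - x i).valMinAbs : ℤ) : ℝ)| / (R₀ : ℝ))) *
        (star (localPair dWaveFormFactor L x *ᵥ ψ) ⬝ᵥ (localPair dWaveFormFactor L y *ᵥ ψ)).re) /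
      (L : ℝ) ^ 2 := by
    calc (m₀ - a) * (R₀ : ℝ) ^ 2 = m₀ * (R₀ : ℝ) ^ 2 - a * (R₀ : ℝ) ^ 2 := by ring
      _ ≤ m₀ * (R₀ : ℝ) ^ 2 - C / (L : ℝ) := by linarith
      _ ≤ _ := hsound
  -- pointwise one-scale closure
  have hcore := pairStructureFactor_zero_ge_of_seed_of_profile R₀ hR₀ h2R hε hS hA ψ
    (hprof L hLA hE ψ hψ1 hgs) hseed
  rw [pairStructureFactor_zero_eq_re_dotProduct, le_div_iff₀ hL2] at hcore
  rw [le_div_iff₀ (by positivity : (0 : ℝ) < (L : ℝ) ^ 4)]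
  have hgap : a ≤ m₀ - a - 32 * ε * (S * ε + A) - (S + A / ε) / (R₀ : ℝ) ^ 2 := by
    rw [ha_def, hleak_def]; linarith
  calc a * (L : ℝ) ^ 4 = a * (L : ℝ) ^ 2 * (L : ℝ) ^ 2 := by ring
    _ ≤ (m₀ - a - 32 * ε * (S * ε + A) - (S + A / ε) / (R₀ : ℝ) ^ 2) * (L : ℝ) ^ 2 * (L : ℝ) ^ 2 := by
        apply mul_le_mul_of_nonneg_right _ hL2.le
        exact mul_le_mul_of_nonneg_right hgap hL2.le
    _ ≤ _ := hcore

/-- **Pointwise endgame: the crux and the summit.** Under the hypotheses of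
`uniformPairOrder_of_profileAt_of_blockCertified` at a point `U > 0`, `δ ∈ (0, 1/2)` —
(A)'s profile constants THERE plus an eventual family of evaluated block certificates at ONE scale with
a leak-beating margin — both `MesoscopicPairOrder` (by `mesoscopicPairOrder_of_uniformPairOrder`) and
the summit `HubbardSuperconductivity` (by `TwTipContinuation.Negative.summitMatrix_of_everyGSOrder`, as in
`certificateSoundness_proof`) follow. This is the route's endgame in the pointwise accounting of line
`pointwise_split`: no `∀ (U, δ)` statement is consumed. [folklore] -/
theorem meso_and_summit_of_profileAt_of_blockCertified {U δ S A ε m₀ C : ℝ} {R₀ L_A L_B : ℕ}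
    (hU : 0 < U) (hδ : δ ∈ Set.Ioo (0:ℝ) (1 / 2))
    (hS : 0 ≤ S) (hA : 0 ≤ A) (hR₀ : 0 < R₀) (hε : 0 < ε)
    (hleak : 32 * ε * (S * ε + A) + (S + A / ε) / (R₀ : ℝ) ^ 2 < m₀)
    (hprof : ∀ (L : ℕ) [NeZero L], L_A ≤ L → Even L →
      ∀ ψ : Fock (Orb (FermionTorus 2 L)), star ψ ⬝ᵥ ψ = 1 →
        IsGroundStateInSector (hubbardTorus 2 L 1 U) (2 * ⌊(1 - δ) * (L : ℝ) ^ 2 / 2⌋₊) 0 ψ →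
          ∀ m : TorusSite 2 L, m ≠ 0 →
            pairStructureFactor dWaveFormFactor L ψ m ≤ S + A / Real.sqrt (momentumNormSq L m))
    (hcert : ∀ (L : ℕ) [NeZero L], L_B ≤ L → Even L →
      ∃ (n m : ℕ)
        (O : Fin n → Matrix (Finset (Orb (FermionTorus 2 L))) (Finset (Orb (FermionTorus 2 L))) ℂ)
        (Q : Fin m → Matrix (Finset (Orb (FermionTorus 2 L))) (Finset (Orb (FermionTorus 2 L))) ℂ)
        (R T : Matrix (Finset (Orb (FermionTorus 2 L))) (Finset (Orb (FermionTorus 2 L))) ℂ),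
        (∀ (i : Fin m) (ψ : Fock (Orb (FermionTorus 2 L))),
          ψ ∈ szSector (2 * ⌊(1 - δ) * (L : ℝ) ^ 2 / 2⌋₊) 0 →
            Q i *ᵥ ψ ∈ szSector (2 * ⌊(1 - δ) * (L : ℝ) ^ 2 / 2⌋₊) 0) ∧
        (∀ ψ : Fock (Orb (FermionTorus 2 L)),
          ψ ∈ szSector (2 * ⌊(1 - δ) * (L : ℝ) ^ 2 / 2⌋₊) 0 → star ψ ⬝ᵥ T *ᵥ ψ = 0) ∧
        (1 / (L : ℂ) ^ 2) • (∑ x : TorusSite 2 L, ∑ y : TorusSite 2 L,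
            ((∏ i : Fin 2, max 0 (1 - |(((y i - x i).valMinAbs : ℤ) : ℝ)| / (R₀ : ℝ)) : ℝ) : ℂ) •
              ((localPair dWaveFormFactor L x)ᴴ * localPair dWaveFormFactor L y)) -
            ((m₀ * (R₀ : ℝ) ^ 2 - C / (L : ℝ) : ℝ) : ℂ) •
              (1 : Matrix (Finset (Orb (FermionTorus 2 L))) (Finset (Orb (FermionTorus 2 L))) ℂ) =
          ∑ i : Fin n, (O i)ᴴ * O i +
            ∑ i : Fin m, (Q i)ᴴ * (hubbardTorus 2 L 1 U * Q i - Q i * hubbardTorus 2 L 1 U) +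
            (hubbardTorus 2 L 1 U * R - R * hubbardTorus 2 L 1 U) + T) :
    MesoscopicPairOrder ∧ _root_.HubbardSuperconductivity := by
  obtain ⟨a, ha, L₀, hupo⟩ :=
    uniformPairOrder_of_profileAt_of_blockCertified hS hA hR₀ hε hleak hprof hcert
  refine ⟨mesoscopicPairOrder_of_uniformPairOrder ⟨U, hU, δ, hδ, a, ha, L₀, hupo⟩, U, hU, δ, hδ, ?_⟩
  refine Summit.HubbardSuperconductivity.TwTipContinuation.Negative.summitMatrix_of_everyGSOrder
    ⟨a, ha, L₀, fun L _ hL hE ψ hψ1 hgs => ?_⟩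
  have h := hupo L hL hE ψ hψ1 hgs
  have hLpos : (0 : ℝ) < L := Nat.cast_pos.2 (Nat.pos_of_ne_zero (NeZero.ne L))
  rwa [le_div_iff₀ (by positivity : (0 : ℝ) < (L : ℝ) ^ 4)] at h

/-- **Registered form** (`mesoAndSummitOfProfileAtOfBlockCertified`, sub-goal of stmt-7331): the pointwise
endgame of line `pointwise_split` — profile constants at ONE point + ONE certified block scale ⇒ the crux and
the summit — one-line verbatim signature. [folklore] -/
theorem mesoAndSummitOfProfileAtOfBlockCertified : ∀ (U δ S A ε m₀ C : ℝ) (R₀ L_A L_B : ℕ), (0 < U) → (δ ∈ Set.Ioo (0:ℝ) (1 / 2)) → (0 ≤ S) → (0 ≤ A) → (0 < R₀) → (0 < ε) → (32 * ε * (S * ε + A) + (S + A / ε) / (R₀ : ℝ) ^ 2 < m₀) → (∀ (L : ℕ) [NeZero L], L_A ≤ L → Even L → ∀ ψ : Fock (Orb (FermionTorus 2 L)), star ψ ⬝ᵥ ψ = 1 → IsGroundStateInSector (hubbardTorus 2 L 1 U) (2 * ⌊(1 - δ) * (L : ℝ) ^ 2 / 2⌋₊) 0 ψ → ∀ m : TorusSite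 2 L, m ≠ 0 → pairStructureFactor dWaveFormFactor L ψ m ≤ S + A / Real.sqrt (momentumNormSq L m)) → (∀ (L : ℕ) [NeZero L], L_B ≤ L → Even L → ∃ (n m : ℕ) (O : Fin n → Matrix (Finset (Orb (FermionTorus 2 L))) (Finset (Orb (FermionTorus 2 L))) ℂ) (Q : Fin m → Matrix (Finset (Orb (FermionTorus 2 L))) (Finset (Orb (FermionTorus 2 L))) ℂ) (R T : Matrix (Finset (Orb (FermionTorus 2 L))) (Finset (Orb (FermionTorus 2 L))) ℂ), (∀ (i : Fin m) (ψ : Fock (Orb (FermionTorus 2 L))), ψ ∈ szSector (2 * ⌊(1 - δ) * (L : ℝ) ^ 2 / 2⌋₊) 0 → Q i *ᵥ ψ ∈ szSector (2 * ⌊(1 - δ) * (L : ℝ) ^ 2 / 2⌋₊) 0) ∧ (∀ ψ : Fock (Orb (FermionTorus 2 L)), ψ ∈ szSector (2 * ⌊(1 - δ) * (L : ℝ) ^ 2 / 2⌋₊) 0 → star ψ ⬝ᵥ T *ᵥ ψ = 0) ∧ (1 / (L : ℂ) ^ 2) • (∑ x : TorusSite 2 L, ∑ y : TorusSite 2 L,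 ((∏ i : Fin 2, max 0 (1 - |(((y i - x i).valMinAbs : ℤ) : ℝ)| / (R₀ : ℝ)) : ℝ) : ℂ) • ((localPair dWaveFormFactor L x)ᴴ * localPair dWaveFormFactor L y)) - ((m₀ * (R₀ : ℝ) ^ 2 - C / (L : ℝ) : ℝ) : ℂ) • (1 : Matrix (Finset (Orb (FermionTorus 2 L))) (Finset (Orb (FermionTorus 2 L))) ℂ) = ∑ i : Fin n, (O i)ᴴ * O i + ∑ i : Fin m, (Q i)ᴴ * (hubbardTorus 2 L 1 U * Q i - Q i * hubbardTorus 2 L 1 U) + (hubbardTorus 2 L 1 U * R - R * hubbardTorus 2 L 1 U) + T) → Summit.HubbardSuperconductivity.HubbardSuperconductivity.Theses.FunctionFieldCertificate.MesoscopicPairOrder ∧ _root_.HubbardSuperconductivity :=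
  fun _ _ _ _ _ _ _ _ _ _ hU hδ hS hA hR₀ hε hleak hprof hcert =>
    meso_and_summit_of_profileAt_of_blockCertified hU hδ hS hA hR₀ hε hleak hprof hcert

end Summit.HubbardSuperconductivity.HubbardSuperconductivity.Theorems.FunctionFieldCertificate
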